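import Mathlib
import HarnessLib
import Summits.HubbardSuperconductivity.HubbardSuperconductivity.Theorems.KLProgrammeKLRegimeTwoVolumeSrcThickSliceZeroGridRows
import Summits.HubbardSuperconductivity.HubbardSuperconductivity.Theorems.KLProgrammeKLRegimeOverlapWtColFlowAll
import Summits.HubbardSuperconductivity.HubbardSuperconductivity.Theorems.KLProgrammeKLRegimeEngineScaleZeroResummedDecayKlEng
import Summits.HubbardSuperconductivity.HubbardSuperconductivity.Theorems.KLProgrammeKLRegimeEngineScaleZeroE4PackageDoors
import Summits.HubbardSuperconductivity.HubbardSuperconductivity.Theorems.KLProgrammeKLRegimeEngineV8DefsU9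
import Summits.HubbardSuperconductivity.HubbardSuperconductivity.Theorems.KLProgrammeKLRegimeEngineV8DoorGfr

/-!
# Route `KLProgramme` — crux K3 ENGINE (stmt-HubbardSuperconductivity-20437 `KLRegimeEngineV17F2`), stub (b) v2, THE LEVELS PACKAGE (ℓ), BLOCK `0`:
# the `d·k = 1` twin of `linkDataPartialF_klEng'` — the partial-block data of the THICK block `(Λ_j, Λ_1]`, `1 ≤ j ≤ d`, sandwiched by the scale-`0`
# fat multipliers, on the flow frame `K_n`, as ONE bundle (cell gate-hubbard-kl, seat p3 g21; pen (R332)(D) «p3 g21 (α) = GO»)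

WHY.  `EngineV8.linkDataPartialF_klEng(')` (…TowerPartialIncrLevStepFKlEng, k3c2-p3 g14 / k3c3-p2 g16) bundles, for every tower block `k ≥ 1` with `2 ≤ d·k`, the
eight data of the partial slice `(Λ_j, Λ_{dk}]` sandwiched by `S(F̃_{dk−1})`; its guard `2 ≤ d·k` serves exactly TWO doors — the sharp Gram
`gram_sliceCT_bgmFat_sharp_klEng` and the α door `alphaWt_blockSliceCT_bgmFat_klEng_flow_all'`, both at fat index `dk − 1 ≥ 1`.  At `dk − 1 = 0` the sandwich
`F̃_0` is the radial plateau, and both data are p3 g21's `…TwoVolumeSrcThickSliceZeroGridRows` for EVERY admissible frame (no window, no history):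
`isGramBoundedR_sliceCT_fatZero_uniform` and `exists_alphaWt_sliceCT_fatZero`.  So block `0` — levels `1 ≤ j ≤ d` (`𝒱_{j+1}@F_j`) and the VL base datum at
level `d − 1` — can be read as ONE thick block step off level `0` (`𝒱_1@F_0`, `exists_sourceProfilesAtLevF_srcWindow_zero` class) through the generic block step,
without the import «grid rows of `E(F_j[K_n])·S_{4M}` at `(Λ_{j+1}, F_j)`, `1 ≤ j < d`» of register #20 (bus l.10537, pen (R332)(C)/(D)).

* §1 `exists_alphaWt_sliceCT_fatZero_unif d` — ONE `D` serving every `1 ≤ J ≤ d` (induction on `d` over `exists_alphaWt_sliceCT_fatZero (J′ := 1)`).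
* §2 **`linkDataBlockZeroF_klEng (d R c″)`** — under `linkDataPartialF_klEng'`'s door prefix VERBATIM (`G P Q c`, `P.WF`, `R.WF2`, `c ≤ klEngC₃6`, `μ ∈ klWindowC`,
  `U ≤ klEngU₀9`, `c″U ≤ 1`, the regime, `klEngL₃/klEngM₃`, `1 ≤ n ≤ n_β+1`, `IsKLRegime`, `HistP … n`, `FrameOK … K_n`, flow-piece oscillation below `n`) and
  `∀ j, 1 ≤ j → j ≤ d → j ≤ n`, the EIGHT conjuncts of `linkDataPartialF_klEng'` at `d·k = 1`: `0 < κ₀`, `κ₀²·8¹ ≤ (√(2Cκe₀))²`,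
  `IsGramBoundedR (S(F̃_0)ᵀC^{K_n}_{(Λ_j,Λ_1]}S(F̃_0)) κ₀` with `κ₀ = √(Cκ·(Λ_1/Λ_0)·(e₀·(8⁰)⁻¹))`, UNWEIGHTED rows / cols `≤ Cb·(M/β)/Λ_j`,
  `Cb·(M/β)/Λ_j ≤ (Cb·(M/β)·4^d/e₀)·4¹`, and the UNWEIGHTED analysis-overlap rows / cols of `E(F_j[K_n])·S(F̃_0[K_n])` `≤ 81·CJ·M/β`, `≤ 162·CJ·M/β`
  (`overlapWt_jump_sums_klEng_flow_all` / `overlapWt_colSum_klEng_flow_all` at `(k, J′) = (0, j)`; `j := 1` is the literal `dk = 1` pair `E(F_1)·S(F̃_0)`).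
  Constants: `Cκ = 8(Λ₁/π + 3/128)(1793Λ₁ + 704)·4^{d+1}/e₀²`, `Cb = D·((1+ΣGfr)⁴ + 1)`, `CJ = 2^d·max CJ_r CJ_c`.
`Z^{K_n}_{Λ_1} ≠ 0` is NOT bundled (as in `partialIncrLevF_le_kitStep_klEng` it is the consumer's hypothesis; on `K_n` it is E1's Z-chain, or p686893 under its
own doors).  Compositions of landed theorems; nothing asserts (ℓ), any stub, K3 or superconductivity.
[cite: BenfattoGiulianiMastropietro2006, §2.7 (2.66)–(2.67), (2.71a), §2.8 (2.77), (2.80)–(2.83), §3 (3.3)]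
-/

noncomputable section

namespace Summit.HubbardSuperconductivity.HubbardSuperconductivity.Theorems.EngineV8

set_option linter.dupNamespace false -- summit = problem name (single-conjunct summit), D-0017

open Classical
open Real Finset Literature.MathematicalPhysics.QuantumLattice Literature.Probability.LatticeModels GrassmannAlgebra
open Literature.MathematicalPhysics.QuantumLattice.FermiRG
open Summit.HubbardSuperconductivity.HubbardSuperconductivity.Theorems.KLProgrammeLegKernels
open Summit.HubbardSuperconductivity.HubbardSuperconductivity.Theorems.KLRegimeSplit
open Summit.HubbardSuperconductivity.HubbardSuperconductivity.Theorems.DispersionFlow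
open Summit.HubbardSuperconductivity.HubbardSuperconductivity.Theorems.TorusFourierL2
open Summit.HubbardSuperconductivity.HubbardSuperconductivity.Theorems.TwoVolumeSource
open Summit.HubbardSuperconductivity.HubbardSuperconductivity.Theorems.ScaleZeroDecay

/-! ## §1 One `α` constant for all thick blocks `(Λ_J, Λ_1]`, `1 ≤ J ≤ d` -/

/-- **ONE absolute `D = D(d)` bounding the `klScaleWt`-weighted rows and columns of `S(F̃_0)ᵀC^K_{(Λ_J,Λ_1]}S(F̃_0)` for EVERY `1 ≤ J ≤ d`**, every admissible
frame, any rate `r`: `≤ (M/β)·D·(1+ΣGfr)⁴` (induction on `d` over `exists_alphaWt_sliceCT_fatZero (J′ := 1)`).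
[cite: BenfattoGiulianiMastropietro2006, §2.8 (2.81), §3 (3.3)] -/
theorem exists_alphaWt_sliceCT_fatZero_unif (d : ℕ) : ∃ D : ℝ, 1 ≤ D ∧ ∀ J : ℕ, 1 ≤ J → J ≤ d →
    ∀ (R : RenConsts) (U μ β : ℝ) (Nsc : ℕ) (K : TrigPolyC4v), R.WF → |U| ≤ 1 → (((Nsc : ℕ) : ℝ) + 1) * U ^ 2 ≤ 1 / 2 →
      FrameOK R U Nsc μ K → klBetaMin ≤ β → ∀ (V M : ℕ) [NeZero V] [NeZero M], klEngL₃ β U ≤ V → klEngM₃ β U V ≤ M → ∀ r : ℕ,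
      (∀ Y, ∑ Y', ‖((sectorSubMatrix V M β (bgmFatMultiplier V M klE0 β (nambuXiCT V μ K) 0)).transpose *
          hubbardCovSliceCT V M β μ 0 K (klScale klE0 J) (klScale klE0 1) * sectorSubMatrix V M β (bgmFatMultiplier V M klE0 β (nambuXiCT V μ K) 0)) Y Y'‖ *
          klScaleWt V M β r {latticeLegPos (2 * (2 * M)) Y, latticeLegPos (2 * (2 * M)) Y'} ≤ (M : ℝ) / β * (D * (1 + R.Gfr 0 + R.Gfr 1 + R.Gfr 2 + R.Gfr 3) ^ 4)) ∧
      (∀ Y', ∑ Y, ‖((sectorSubMatrix V M β (bgmFatMultiplier V M klE0 β (nambuXiCT V μ K) 0)).transpose *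
          hubbardCovSliceCT V M β μ 0 K (klScale klE0 J) (klScale klE0 1) * sectorSubMatrix V M β (bgmFatMultiplier V M klE0 β (nambuXiCT V μ K) 0)) Y Y'‖ *
          klScaleWt V M β r {latticeLegPos (2 * (2 * M)) Y, latticeLegPos (2 * (2 * M)) Y'} ≤ (M : ℝ) / β * (D * (1 + R.Gfr 0 + R.Gfr 1 + R.Gfr 2 + R.Gfr 3) ^ 4)) := by
  induction d with
  | zero => exact ⟨1, le_rfl, fun J hJ1 hJ0 => by exfalso; omega⟩
  | succ d ih =>
    obtain ⟨D₀, hD₀, h₀⟩ := ih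
    obtain ⟨D₁, hD₁, h₁⟩ := exists_alphaWt_sliceCT_fatZero (J := d + 1) (J' := 1) (by omega)
    refine ⟨max D₀ D₁, hD₀.trans (le_max_left _ _), fun J hJ1 hJd R U μ β Nsc K hR hU1 hN hK hβ V M _ _ hL hM r => ?_⟩
    have hβ0 : 0 < β := beta_pos_of_klBetaMin_le hβ
    have hG : 0 ≤ (1 + R.Gfr 0 + R.Gfr 1 + R.Gfr 2 + R.Gfr 3) ^ 4 := by positivity
    have hmono : ∀ {A B : ℝ}, A ≤ B → (M : ℝ) / β * (A * (1 + R.Gfr 0 + R.Gfr 1 + R.Gfr 2 + R.Gfr 3) ^ 4) ≤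
        (M : ℝ) / β * (B * (1 + R.Gfr 0 + R.Gfr 1 + R.Gfr 2 + R.Gfr 3) ^ 4) :=
      fun h => mul_le_mul_of_nonneg_left (mul_le_mul_of_nonneg_right h hG) (by positivity)
    rcases Nat.lt_or_ge J (d + 1) with hlt | hge
    · obtain ⟨hr, hc⟩ := h₀ J hJ1 (by omega) R U μ β Nsc K hR hU1 hN hK hβ V M hL hM r
      exact ⟨fun Y => (hr Y).trans (hmono (le_max_left _ _)), fun Y' => (hc Y').trans (hmono (le_max_left _ _))⟩
    · obtain rfl : J = d + 1 := le_antisymm hJd hge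
      obtain ⟨hr, hc⟩ := h₁ R U μ β Nsc K hR hU1 hN hK hβ V M hL hM r
      exact ⟨fun Y => (hr Y).trans (hmono (le_max_right _ _)), fun Y' => (hc Y').trans (hmono (le_max_right _ _))⟩

/-! ## §2 The block-`0` bundle on the flow frame -/

/-- **THE BLOCK-`0` (THICK BLOCK FROM `J₁ = 1`) DATA ON THE FLOW FRAME `K_n`, AS ONE BUNDLE — the `d·k = 1` twin of `linkDataPartialF_klEng'`**: under its
door prefix verbatim, for every `j` with `1 ≤ j ≤ d`, `j ≤ n`: the Gram constant `κ₀ = √(Cκ·(Λ_1/Λ_0)·(e₀·(8⁰)⁻¹))` of `S(F̃_0)ᵀ C^{K_n}_{(Λ_j, Λ_1]} S(F̃_0)` (positive,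
`κ₀²·8¹ ≤ (√(2Cκe₀))²`, `IsGramBoundedR`), its UNWEIGHTED rows / cols `≤ α_j = Cb·(M/β)/Λ_j ≤ (Cb·(M/β)·4^d/e₀)·4¹`, and the UNWEIGHTED analysis-overlap rows /
cols of `E(F_j[K_n])·S(F̃_0[K_n])` `≤ 81·CJ·M/β`, `≤ 162·CJ·M/β` (`j := 1` gives the literal `dk = 1` pair `E(F_1)·S(F̃_0)`).
[cite: BenfattoGiulianiMastropietro2006, §2.7 (2.66)-(2.67), (2.71a), §2.8 (2.77), (2.80)-(2.83)] -/
theorem linkDataBlockZeroF_klEng (d : ℕ) (R : RenConsts) (c'' : ℝ) (hc'' : 0 < c'') :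
    ∃ Cκ Cb CJ : ℝ, 0 < Cκ ∧ 0 < Cb ∧ 0 < CJ ∧
      ∀ (G : GeoConsts) (P : SplitConsts) (Q : EngConsts) (c : ℝ), P.WF → R.WF2 → 0 < c → c ≤ klEngC₃6 P R →
      ∀ μ ∈ klWindowC, ∀ U : ℝ, 0 < U → U ≤ klEngU₀9 P R c → c'' * U ≤ 1 →
      ∀ β : ℝ, klBetaMin ≤ β → β ≤ Real.exp (c / U ^ 2) →
      ∀ (L M : ℕ) [NeZero L] [NeZero M], klEngL₃ β U ≤ L → klEngM₃ β U L ≤ M →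
      ∀ n : ℕ, 1 ≤ n → n ≤ nScales β + 1 → IsKLRegime U c (-(n : ℤ)) →
        HistP klPredsV17F2 L M G P Q R β U μ 0 n → FrameOK R U (nScales β) μ (klFlowFrameU L M β U μ n) →
        (∀ m, 1 ≤ m → m < n → FlowPieceOscAt L M c'' β U μ m) →
      ∀ j : ℕ, 1 ≤ j → j ≤ d → j ≤ n →
        0 < Real.sqrt (Cκ * (klScale klE0 1 / klScale klE0 0) * (klE0 * ((8 : ℝ) ^ 0)⁻¹)) ∧
        Real.sqrt (Cκ * (klScale klE0 1 / klScale klE0 0) * (klE0 * ((8 : ℝ) ^ 0)⁻¹)) ^ 2 * (8 : ℝ) ^ 1 ≤ Real.sqrt (2 * Cκ * klE0) ^ 2 ∧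
        IsGramBoundedR ((sectorSubMatrix L M β (bgmFatMultiplier L M klE0 β (nambuXiCT L μ (klFlowFrameU L M β U μ n)) 0)).transpose *
            hubbardCovSliceCT L M β μ 0 (klFlowFrameU L M β U μ n) (klScale klE0 j) (klScale klE0 1) *
            sectorSubMatrix L M β (bgmFatMultiplier L M klE0 β (nambuXiCT L μ (klFlowFrameU L M β U μ n)) 0))
          (Real.sqrt (Cκ * (klScale klE0 1 / klScale klE0 0) * (klE0 * ((8 : ℝ) ^ 0)⁻¹))) ∧
        (∀ X, ∑ Y, ‖((sectorSubMatrix L M β (bgmFatMultiplier L M klE0 β (nambuXiCT L μ (klFlowFrameU L M β U μ n)) 0)).transpose *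
            hubbardCovSliceCT L M β μ 0 (klFlowFrameU L M β U μ n) (klScale klE0 j) (klScale klE0 1) *
            sectorSubMatrix L M β (bgmFatMultiplier L M klE0 β (nambuXiCT L μ (klFlowFrameU L M β U μ n)) 0)) X Y‖ ≤ Cb * ((M : ℝ) / β) / klScale klE0 j) ∧
        (∀ Y, ∑ X, ‖((sectorSubMatrix L M β (bgmFatMultiplier L M klE0 β (nambuXiCT L μ (klFlowFrameU L M β U μ n)) 0)).transpose *
            hubbardCovSliceCT L M β μ 0 (klFlowFrameU L M β U μ n) (klScale klE0 j) (klScale klE0 1) *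
            sectorSubMatrix L M β (bgmFatMultiplier L M klE0 β (nambuXiCT L μ (klFlowFrameU L M β U μ n)) 0)) X Y‖ ≤ Cb * ((M : ℝ) / β) / klScale klE0 j) ∧
        Cb * ((M : ℝ) / β) / klScale klE0 j ≤ Cb * ((M : ℝ) / β) * (4 : ℝ) ^ d / klE0 * (4 : ℝ) ^ 1 ∧
        (∀ X'' : SpaceTimeIdx L M × SectorLeg (sectorCount j), ∑ X' : SpaceTimeIdx L M × SectorLeg (sectorCount 0),
          ‖(sectorAnalysisMatrix L M β (klAnisoFamily L M β μ (klFlowFrameU L M β U μ n) klE0 j) *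
            sectorSubMatrix L M β (bgmFatMultiplier L M klE0 β (nambuXiCT L μ (klFlowFrameU L M β U μ n)) 0)) X'' X'‖ ≤ 81 * CJ * M / β) ∧
        (∀ X' : SpaceTimeIdx L M × SectorLeg (sectorCount 0), ∑ X'' : SpaceTimeIdx L M × SectorLeg (sectorCount j),
          ‖(sectorAnalysisMatrix L M β (klAnisoFamily L M β μ (klFlowFrameU L M β U μ n) klE0 j) *
            sectorSubMatrix L M β (bgmFatMultiplier L M klE0 β (nambuXiCT L μ (klFlowFrameU L M β U μ n)) 0)) X'' X'‖ ≤ 162 * CJ * M / β) := by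
  obtain ⟨D, hD1, hD⟩ := exists_alphaWt_sliceCT_fatZero_unif d
  obtain ⟨CJr, hCJr, hopr⟩ := overlapWt_jump_sums_klEng_flow_all R c'' hc''.le
  obtain ⟨CJc, hCJc, hopc⟩ := overlapWt_colSum_klEng_flow_all R c'' hc''.le
  have he : (0 : ℝ) < klE0 := by norm_num [klE0]
  have he1 : klE0 ≤ 1 := by norm_num [klE0]
  have hΛ1 : 0 < klScale klE0 1 := klth_klScale_pos 1
  have hA0 : 0 < 8 * (klScale klE0 1 / Real.pi + 3 / 128) * (1793 * klScale klE0 1 + 704) := by positivity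
  have hG4 : 0 ≤ (1 + R.Gfr 0 + R.Gfr 1 + R.Gfr 2 + R.Gfr 3) ^ 4 := by positivity
  have hmx : (0 : ℝ) < max CJr CJc := lt_max_iff.2 (Or.inl hCJr)
  refine ⟨8 * (klScale klE0 1 / Real.pi + 3 / 128) * (1793 * klScale klE0 1 + 704) * (4 : ℝ) ^ (d + 1) / klE0 ^ 2,
    D * ((1 + R.Gfr 0 + R.Gfr 1 + R.Gfr 2 + R.Gfr 3) ^ 4 + 1), (2 : ℝ) ^ d * max CJr CJc, by positivity, by positivity, by positivity, ?_⟩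
  intro G P Q c hP hR2 hc hc6 μ hμ U hU hU9 hcU β hβmin hβc L M _ _ hL3 hM3 n hn1 hnN hreg hhist hfr hosc j hj1 hjd hjn
  have hβ : 0 < β := pos_of_klBetaMin_le hβmin
  have hM0 : (0 : ℝ) < M := Nat.cast_pos.2 (Nat.pos_of_ne_zero (NeZero.ne M))
  have hMβ : 0 < (M : ℝ) / β := by positivity
  have hU3 : U ≤ klEngU₀3 P R c := hU9.trans (klEngU₀9_le_klEngU₀3 P R c)
  have hU3g : U ≤ min (klEngU₀3 P R c) (1 / (R.Gfr 3 + 1)) :=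
    le_min hU3 (hU9.trans (klEngU₀9_le_inv_gfr_add_one P hR2.wf c (by norm_num)))
  have hU1 : |U| ≤ 1 := abs_le_one_of_le_klEngU₀3 hU hU3
  have hcD : c ≤ klE4C₃ R := hc6.trans (klEngC₃6_le_klE4C₃ P R)
  have hN : (((nScales β : ℕ) : ℝ) + 1) * U ^ 2 ≤ 1 / 2 :=
    (nScales_succ_mul_sq_le (U := U) hc.le hβmin hβc).trans (div_log_four_le_half_of_door hcD)
  -- the data
  obtain ⟨hrow, hcol⟩ := hD j hj1 hjd R U μ β (nScales β) (klFlowFrameU L M β U μ n) hR2.wf hU1 hN hfr hβmin L M hL3 hM3 j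
  have hgram := isGramBoundedR_sliceCT_fatZero_uniform (V := L) (M := M) hfr hβmin hj1
  obtain ⟨hr', -, -⟩ := hopr G P Q c hR2 hc hc6 μ hμ U hU hU3g hcU β hβmin hβc L M hL3 hM3 n hn1 hnN hreg hhist hosc 0 j (by omega) hjn
  have hc' := hopc G P Q c hR2 hc hc6 μ hμ U hU hU3g hcU β hβmin hβc L M hL3 hM3 n hn1 hnN hreg hhist hosc 0 j (by omega) hjn j le_rfl
  -- constants
  have hq : klScale klE0 1 / klScale klE0 0 = 1 / 4 := by
    rw [div_eq_iff (klth_klScale_pos 0).ne']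
    unfold klScale
    ring
  have hinner : 8 * (klScale klE0 1 / Real.pi + 3 / 128) * (1793 * klScale klE0 1 + 704) * (4 : ℝ) ^ (d + 1) / klE0 ^ 2 *
      (klScale klE0 1 / klScale klE0 0) * (klE0 * ((8 : ℝ) ^ 0)⁻¹) =
      8 * (klScale klE0 1 / Real.pi + 3 / 128) * (1793 * klScale klE0 1 + 704) * (4 : ℝ) ^ d / klE0 := by
    rw [hq, pow_zero, inv_one, mul_one, pow_succ]
    field_simp
  have hΛj1 : klScale klE0 j ≤ 1 := by
    obtain ⟨-, h1, h2⟩ := klScale_thick_facts (Nat.zero_le j)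
    exact h1.trans (h2.trans he1)
  have hΛjpos : 0 < klScale klE0 j := klth_klScale_pos j
  have hΛjinv : 1 / klScale klE0 j ≤ (4 : ℝ) ^ d / klE0 := by
    have h4 : (4 : ℝ) ^ j ≤ (4 : ℝ) ^ d := pow_le_pow_right₀ (by norm_num) hjd
    have e : 1 / klScale klE0 j = (4 : ℝ) ^ j / klE0 := by
      unfold klScale
      field_simp
    rw [e]
    exact div_le_div_of_nonneg_right h4 he.le
  have hstrip : ∀ {ι : Type} {a : ℝ} (s : Finset ι) (f : ι → ℂ) (S : ι → Finset (ZMod (2 * (2 * M)) × TorusSite 2 L)),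
      ∑ i ∈ s, ‖f i‖ * klScaleWt L M β j (S i) ≤ a → ∑ i ∈ s, ‖f i‖ ≤ a := fun s f S h =>
    le_trans (sum_le_sum fun i _ => le_mul_of_one_le_right (norm_nonneg _) (one_le_klScaleWt L M β j (S i))) h
  have hαj : (M : ℝ) / β * (D * (1 + R.Gfr 0 + R.Gfr 1 + R.Gfr 2 + R.Gfr 3) ^ 4) ≤
      D * ((1 + R.Gfr 0 + R.Gfr 1 + R.Gfr 2 + R.Gfr 3) ^ 4 + 1) * ((M : ℝ) / β) / klScale klE0 j := by
    rw [le_div_iff₀ hΛjpos]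
    have hD0 : 0 ≤ D := zero_le_one.trans hD1
    calc (M : ℝ) / β * (D * (1 + R.Gfr 0 + R.Gfr 1 + R.Gfr 2 + R.Gfr 3) ^ 4) * klScale klE0 j
        ≤ (M : ℝ) / β * (D * (1 + R.Gfr 0 + R.Gfr 1 + R.Gfr 2 + R.Gfr 3) ^ 4) * 1 :=
          mul_le_mul_of_nonneg_left hΛj1 (by positivity)
      _ ≤ (M : ℝ) / β * (D * ((1 + R.Gfr 0 + R.Gfr 1 + R.Gfr 2 + R.Gfr 3) ^ 4 + 1)) := by
          rw [mul_one]
          exact mul_le_mul_of_nonneg_left (mul_le_mul_of_nonneg_left (by linarith) hD0) hMβ.le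
      _ = _ := by ring
  refine ⟨?_, ?_, ?_, ?_, ?_, ?_, ?_, ?_⟩
  · rw [hinner]; positivity
  · rw [Real.sq_sqrt (by rw [hinner]; positivity), Real.sq_sqrt (by positivity), hinner, pow_one]
    apply le_of_eq
    field_simp
    ring
  · refine IsGramBoundedR.mono hgram (Real.sqrt_nonneg _) (Real.sqrt_le_sqrt ?_)
    rw [hinner, div_eq_mul_one_div _ (klScale klE0 j), mul_div_assoc]
    exact mul_le_mul_of_nonneg_left hΛjinv hA0.le
  · exact fun X => (hstrip _ _ _ (hrow X)).trans hαj
  · exact fun Y => (hstrip _ _ _ (hcol Y)).trans hαj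
  · have h0 : 0 ≤ D * ((1 + R.Gfr 0 + R.Gfr 1 + R.Gfr 2 + R.Gfr 3) ^ 4 + 1) * ((M : ℝ) / β) := by positivity
    calc D * ((1 + R.Gfr 0 + R.Gfr 1 + R.Gfr 2 + R.Gfr 3) ^ 4 + 1) * ((M : ℝ) / β) / klScale klE0 j
        = D * ((1 + R.Gfr 0 + R.Gfr 1 + R.Gfr 2 + R.Gfr 3) ^ 4 + 1) * ((M : ℝ) / β) * (1 / klScale klE0 j) := by ring
      _ ≤ D * ((1 + R.Gfr 0 + R.Gfr 1 + R.Gfr 2 + R.Gfr 3) ^ 4 + 1) * ((M : ℝ) / β) * ((4 : ℝ) ^ d / klE0) :=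
          mul_le_mul_of_nonneg_left hΛjinv h0
      _ ≤ D * ((1 + R.Gfr 0 + R.Gfr 1 + R.Gfr 2 + R.Gfr 3) ^ 4 + 1) * ((M : ℝ) / β) * ((4 : ℝ) ^ d / klE0) * (4 : ℝ) ^ 1 :=
          le_mul_of_one_le_right (by positivity) (by norm_num)
      _ = _ := by ring
  · intro X''
    refine (hstrip _ _ _ (hr' X'')).trans ?_
    have h1 : CJr ≤ (2 : ℝ) ^ d * max CJr CJc :=
      le_trans (le_max_left _ _) (le_mul_of_one_le_left hmx.le (one_le_pow₀ (by norm_num)))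
    have e1 : 81 * CJr * M / β = 81 * CJr * ((M : ℝ) / β) := by ring
    have e2 : 81 * ((2 : ℝ) ^ d * max CJr CJc) * M / β = 81 * ((2 : ℝ) ^ d * max CJr CJc) * ((M : ℝ) / β) := by ring
    rw [e1, e2]
    exact mul_le_mul_of_nonneg_right (mul_le_mul_of_nonneg_left h1 (by norm_num)) hMβ.le
  · intro X'
    refine (hstrip _ _ _ (hc' X')).trans ?_
    rw [Nat.sub_zero]
    have h2 : (2 : ℝ) ^ j ≤ (2 : ℝ) ^ d := pow_le_pow_right₀ (by norm_num) hjd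
    have hmax : CJc ≤ max CJr CJc := le_max_right _ _
    have h3 : 81 * (2 : ℝ) ^ j * CJc ≤ 162 * ((2 : ℝ) ^ d * max CJr CJc) := by
      have h4 : (2 : ℝ) ^ j * CJc ≤ (2 : ℝ) ^ d * max CJr CJc := mul_le_mul h2 hmax hCJc.le (by positivity)
      have h5 : 0 ≤ (2 : ℝ) ^ d * max CJr CJc := by positivity
      calc 81 * (2 : ℝ) ^ j * CJc = 81 * ((2 : ℝ) ^ j * CJc) := by ring
        _ ≤ 81 * ((2 : ℝ) ^ d * max CJr CJc) := mul_le_mul_of_nonneg_left h4 (by norm_num)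
        _ ≤ 162 * ((2 : ℝ) ^ d * max CJr CJc) := by linarith
    have e1 : 81 * (2 : ℝ) ^ j * CJc * M / β = 81 * (2 : ℝ) ^ j * CJc * ((M : ℝ) / β) := by ring
    have e2 : 162 * ((2 : ℝ) ^ d * max CJr CJc) * M / β = 162 * ((2 : ℝ) ^ d * max CJr CJc) * ((M : ℝ) / β) := by ring
    rw [e1, e2]
    exact mul_le_mul_of_nonneg_right h3 hMβ.le

end Summit.HubbardSuperconductivity.HubbardSuperconductivity.Theorems.EngineV8

end
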